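import Literature.AlgebraicGeometry.Frobenioids.ArithmeticFrobenioidThm64ivEquivariance
import Literature.AlgebraicGeometry.Frobenioids.ArithmeticFrobenioidThm64ivCompatOfConj
import Mathlib.NumberTheory.NumberField.InfinitePlace.Ramification
import HarnessLib

/-!
# Frobenioids I, Thm. 6.4 (iv) at the constructions: archimedean rigidity ⟹ the conjugation identity ⟹
# the compatibility clause, whenever `Gal(L₁/ℚ)` acts faithfully on the infinite places

Mochizuki, *The geometry of Frobenioids I: the general theory*, Kyushu J. Math. **62** (2008) 293–400, §6,
Thm. 6.4 (iv) p. 115 l. 17–29 [cite: MochizukiFrdI2008, Thm. 6.4 (iv) p.115].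

PROOF-ONLY file (cell abc-iut, GAP-LEDGER row G-L1t3-1 #2; seat abc-iut-w4-d090; the GLUE of abc-iut-L1-d3's
archimedean-rigidity programme for the non-Galois clause).  Inputs, all by name: the Cor. 4.11 (iv) datum
`E = Ψ^Φ` with the archimedean decomposition `(θ, c)` of `Ψ^Φ_X` (`EffArithDivisor.exists_decomposition_monomial_mulEquiv`),
a field isomorphism `e : X.L ≅ L₂ := (Ψ^Base X).L` (`Thm64iv_arith_fieldIso`), and the RIGIDITY output
`hs : θ v ∘ e = s • v` for one `s ∈ Gal(X.L/ℚ)` (abc-iut-L1-d3's `exists_algEquiv_forall_eq_smul`).  Then: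
* `arith_conj_of_rigidity` — if `Gal(X.L/ℚ)` acts FAITHFULLY on the infinite places of `X.L` (`hZ`; e.g. `X.L`
  has a real place: `forall_smul_eq_imp_eq_one_of_isReal`), then `Ψ^Base` is conjugation by `e ∘ s` on
  `Aut_{D₁}(X)`: `Ψ^Base(h) (e x) = e (s (h (s⁻¹ x)))` — equivariance of `θ` (`arith_infinitePlaceEquiv_equivariant`)
  turns `hs` into `(s h⁻¹) • v = (α(h)⁻¹ s) • v` for `α(h) := e⁻¹ Ψ^Base(h) e`, and faithfulness gives
  `α(h) = s h s⁻¹`;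
* `nonempty_baseRingEquiv_of_rigidity` / `Thm64iv_arith_compat_of_rigidity` — hence `F₁ ≅ F₂` and THE CLAUSE at
  `X` (`nonempty_baseRingEquiv_of_conj` / `Thm64iv_arith_compat_of_conj`).
The complementary case (all infinite places of `X.L` complex with a central complex conjugation, i.e. `X.L` CM)
is NOT treated here.  No definitions, no named facts; nothing here bears on [IUTchIII] Cor. 3.12 or abc.
-/

noncomputable section

namespace Literature.AlgebraicGeometry.Frobenioids

open CategoryTheory NumberField

/-! ### Faithfulness of `Gal(L/ℚ)` on infinite places from a real place -/

/-- If the Galois number field `L` has a real place, `Gal(L/ℚ)` acts faithfully on its infinite places (the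
stabiliser of a real place is trivial). [cite: MochizukiFrdI2008, Thm. 6.4 (iv) p.115] -/
theorem forall_smul_eq_imp_eq_one_of_isReal {L : Type*} [Field L] [NumberField L]
    {v₀ : InfinitePlace L} (hv₀ : v₀.IsReal) (g : L ≃ₐ[ℚ] L) (hg : ∀ v : InfinitePlace L, g • v = v) :
    g = 1 := by
  have hmem : g ∈ MulAction.stabilizer (L ≃ₐ[ℚ] L) v₀ := MulAction.mem_stabilizer_iff.mpr (hg v₀)
  rw [(hv₀.isUnramified (k := ℚ)).stabilizer_eq_bot, Subgroup.mem_bot] at hmem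
  exact hmem

section Arith

variable {F₁ : Type} [Field F₁] [NumberField F₁] {K₁ : Type} [Field K₁] [Algebra F₁ K₁]
variable {F₂ : Type} [Field F₂] [NumberField F₂] {K₂ : Type} [Field K₂] [Algebra F₂ K₂]

/-- **Archimedean rigidity ⟹ the conjugation identity** (faithful case).  For the Cor. 4.11 (iv) datum
`E = Ψ^Φ` with archimedean decomposition `(θ, c)` at `X`, a field isomorphism `e : X.L ≅ (Ψ^Base X).L`, an
`s ∈ Gal(X.L/ℚ)` with `θ v ∘ e = s • v` for all infinite places `v`, and `Gal(X.L/ℚ)` acting faithfully on the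
infinite places: `Ψ^Base(h) (e x) = e (s (h (s⁻¹ x)))` for every `h ∈ Aut_{D₁}(X)` and `x ∈ X.L`.
[cite: MochizukiFrdI2008, Thm. 6.4 (iv) p.115] -/
theorem arith_conj_of_rigidity {ΨBase : FinSubextCat F₁ K₁ ⥤ FinSubextCat F₂ K₂}
    (E : PreFrobenioidData.DivisorMonoidIsoOverBase (arithFrobenioidOps F₁ K₁) (arithFrobenioidOps F₂ K₂) ΨBase)
    (X : FinSubextCat F₁ K₁) (θ : InfinitePlace X.L ≃ InfinitePlace (ΨBase.obj X).L)
    (c : InfinitePlace X.L → NNReal) (hc : ∀ v, c v ≠ 0)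
    (hθ : ∀ (D : EffArithDivisor X.L) (v : InfinitePlace X.L),
      (Multiplicative.toAdd (E.iso X (Multiplicative.ofAdd D))).2 (θ v) = c v * D.2 v)
    (e : X.L ≃+* (ΨBase.obj X).L) (s : X.L ≃ₐ[ℚ] X.L)
    (hs : ∀ v : InfinitePlace X.L, (θ v).comap e.toRingHom = s • v)
    (hZ : ∀ g : X.L ≃ₐ[ℚ] X.L, (∀ v : InfinitePlace X.L, g • v = v) → g = 1)
    (h : X ≅ X) (x : X.L) :
    (ΨBase.map h.hom).toAlgHom (e x) = e (s (h.hom.toAlgHom (s.symm x))) := by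
  -- the ring automorphisms `hR` of `X.L` (from `h`), `ψR` of `L₂` (from `Ψ^Base h`), and `α := e⁻¹ ∘ ψR ∘ e`
  have h₁ := FinSubextCat.iso_toRingHom_comp h
  have h₂ := FinSubextCat.iso_toRingHom_comp' h
  have g₁ := FinSubextCat.iso_toRingHom_comp (ΨBase.mapIso h)
  have g₂ := FinSubextCat.iso_toRingHom_comp' (ΨBase.mapIso h)
  rw [Functor.mapIso_hom, Functor.mapIso_inv] at g₁ g₂
  let hR : X.L ≃+* X.L :=
    RingEquiv.ofRingHom h.hom.toAlgHom.toRingHom h.inv.toAlgHom.toRingHom h₁ h₂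
  let ψR : (ΨBase.obj X).L ≃+* (ΨBase.obj X).L :=
    RingEquiv.ofRingHom (ΨBase.map h.hom).toAlgHom.toRingHom (ΨBase.map h.inv).toAlgHom.toRingHom g₁ g₂
  let α : X.L ≃+* X.L := e.trans (ψR.trans e.symm)
  -- as `ℚ`-algebra automorphisms of `X.L`
  let hQ : X.L ≃ₐ[ℚ] X.L := AlgEquiv.ofRingEquiv (f := hR) fun q => (hR : X.L →+* X.L).map_rat_algebraMap q
  let αQ : X.L ≃ₐ[ℚ] X.L := AlgEquiv.ofRingEquiv (f := α) fun q => (α : X.L →+* X.L).map_rat_algebraMap q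
  have hcoe_h : (hQ : X.L →+* X.L) = h.hom.toAlgHom.toRingHom := RingHom.ext fun _ => rfl
  have hcoe_α : (αQ : X.L →+* X.L) = α.toRingHom := RingHom.ext fun _ => rfl
  -- `Ψ^Base(h) ∘ e = e ∘ α`
  have hψe : (ΨBase.map h.hom).toAlgHom.toRingHom.comp e.toRingHom = e.toRingHom.comp α.toRingHom :=
    RingHom.ext fun y => (e.apply_symm_apply _).symm
  -- (1) equivariance of `θ` + rigidity: `s • (v ∘ h) = (s • v) ∘ α`
  have EQ : ∀ v : InfinitePlace X.L,
      s • (v.comap h.hom.toAlgHom.toRingHom) = (s • v).comap α.toRingHom := fun v => by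
    have h1 := (arith_infinitePlaceEquiv_equivariant E X θ c hc hθ h.hom v).1
    have h2 := congrArg (fun w : InfinitePlace (ΨBase.obj X).L => w.comap e.toRingHom) h1
    rw [hs, ← InfinitePlace.comap_comp, hψe, InfinitePlace.comap_comp, hs] at h2
    exact h2
  -- (2) in the Galois action: `(s hQ⁻¹) • v = (αQ⁻¹ s) • v`
  have EQ' : ∀ v : InfinitePlace X.L, (s * hQ.symm) • v = (αQ.symm * s) • v := fun v => by
    have e1 : hQ.symm • v = v.comap h.hom.toAlgHom.toRingHom := by
      rw [InfinitePlace.smul_eq_comap, AlgEquiv.symm_symm, hcoe_h]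
    have e2 : αQ.symm • (s • v) = (s • v).comap α.toRingHom := by
      rw [InfinitePlace.smul_eq_comap, AlgEquiv.symm_symm, hcoe_α]
    rw [mul_smul, mul_smul, e1, e2]
    exact EQ v
  -- (3) faithfulness: `αQ⁻¹ s = s hQ⁻¹`
  have hg : ∀ v : InfinitePlace X.L, ((αQ.symm * s)⁻¹ * (s * hQ.symm)) • v = v := fun v => by
    rw [mul_smul, EQ' v, ← mul_smul, inv_mul_cancel, one_smul]
  have hone := hZ _ hg
  rw [inv_mul_eq_one] at hone
  -- (4) evaluate at `hQ (s⁻¹ x)` and unwind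
  have key := congrArg (fun f : X.L ≃ₐ[ℚ] X.L => αQ (f (hQ (s.symm x)))) hone
  simp only [AlgEquiv.mul_apply, AlgEquiv.apply_symm_apply, AlgEquiv.symm_apply_apply] at key
  -- key : s (hQ (s.symm x)) = αQ x
  have hα : αQ x = e.symm ((ΨBase.map h.hom).toAlgHom (e x)) := rfl
  have hh : hQ (s.symm x) = h.hom.toAlgHom (s.symm x) := rfl
  rw [hα, hh] at key
  rw [key, RingEquiv.apply_symm_apply]

/-- **`F₁ ≅ F₂` from archimedean rigidity** (faithful case): under the hypotheses of
`arith_conj_of_rigidity` with `Ψ^Base` an equivalence and `X.L` Galois over `ℚ`.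
[cite: MochizukiFrdI2008, Thm. 6.4 (iv) p.115] -/
theorem nonempty_baseRingEquiv_of_rigidity {ΨBase : FinSubextCat F₁ K₁ ⥤ FinSubextCat F₂ K₂}
    [ΨBase.IsEquivalence]
    (E : PreFrobenioidData.DivisorMonoidIsoOverBase (arithFrobenioidOps F₁ K₁) (arithFrobenioidOps F₂ K₂) ΨBase)
    (X : FinSubextCat F₁ K₁) (hX : IsGalois ℚ X.L) (θ : InfinitePlace X.L ≃ InfinitePlace (ΨBase.obj X).L)
    (c : InfinitePlace X.L → NNReal) (hc : ∀ v, c v ≠ 0)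
    (hθ : ∀ (D : EffArithDivisor X.L) (v : InfinitePlace X.L),
      (Multiplicative.toAdd (E.iso X (Multiplicative.ofAdd D))).2 (θ v) = c v * D.2 v)
    (e : X.L ≃+* (ΨBase.obj X).L) (s : X.L ≃ₐ[ℚ] X.L)
    (hs : ∀ v : InfinitePlace X.L, (θ v).comap e.toRingHom = s • v)
    (hZ : ∀ g : X.L ≃ₐ[ℚ] X.L, (∀ v : InfinitePlace X.L, g • v = v) → g = 1) :
    Nonempty (F₁ ≃+* F₂) :=
  nonempty_baseRingEquiv_of_conj ΨBase X hX e s.toRingEquiv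
    fun h x => arith_conj_of_rigidity E X θ c hc hθ e s hs hZ h x

/-- **[FrdI] Thm. 6.4 (iv), the compatibility clause at `X`, from archimedean rigidity** (faithful case, e.g.
`X.L` with a real place): `L₂ := (Ψ^Base X).L ≅ L₁ = X.L` compatibly with an isomorphism `F₁ ≅ F₂`, for EVERY
number field `F₁` — no solitary / Galois / degree hypothesis on `F₁`. [cite: MochizukiFrdI2008, Thm. 6.4 (iv) p.115] -/
theorem Thm64iv_arith_compat_of_rigidity {ΨBase : FinSubextCat F₁ K₁ ⥤ FinSubextCat F₂ K₂}
    [ΨBase.IsEquivalence]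
    (E : PreFrobenioidData.DivisorMonoidIsoOverBase (arithFrobenioidOps F₁ K₁) (arithFrobenioidOps F₂ K₂) ΨBase)
    (X : FinSubextCat F₁ K₁) (hX : IsGalois ℚ X.L) (θ : InfinitePlace X.L ≃ InfinitePlace (ΨBase.obj X).L)
    (c : InfinitePlace X.L → NNReal) (hc : ∀ v, c v ≠ 0)
    (hθ : ∀ (D : EffArithDivisor X.L) (v : InfinitePlace X.L),
      (Multiplicative.toAdd (E.iso X (Multiplicative.ofAdd D))).2 (θ v) = c v * D.2 v)
    (e : X.L ≃+* (ΨBase.obj X).L) (s : X.L ≃ₐ[ℚ] X.L)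
    (hs : ∀ v : InfinitePlace X.L, (θ v).comap e.toRingHom = s • v)
    (hZ : ∀ g : X.L ≃ₐ[ℚ] X.L, (∀ v : InfinitePlace X.L, g • v = v) → g = 1) :
    ∃ (e' : X.L ≃+* (ΨBase.obj X).L) (e₀ : F₁ ≃+* F₂),
      ∀ a : F₁, e' (algebraMap F₁ X.L a) = algebraMap F₂ (ΨBase.obj X).L (e₀ a) :=
  Thm64iv_arith_compat_of_conj ΨBase X hX e s.toRingEquiv
    fun h x => arith_conj_of_rigidity E X θ c hc hθ e s hs hZ h x

end Arith

end Literature.AlgebraicGeometry.Frobenioids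

end
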